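import Literature.AnabelianGeometry.EtaleTheta.Thm16SubdagTransport
import HarnessLib

/-!
# [EtTh] Theorem 1.6 (iii) — sub-DAG rows L12–L14, part 6: the `(K̈^×)^∧`-factor relation
# `transport(η̈^Θ_α) = κ(a) · conj_σ(η̈^Θ_β)` from the printed Prop. 1.5 (ii)/(iii) clauses, and the capstone
# `Thm16iii` from print-shaped inputs only (proof-only)

Mochizuki, *The étale theta function and its Frobenioid-theoretic manifestations*, Publ. RIMS **45** (2009),
Thm. 1.6 (iii), proof, PRIMS PDF p. 25 (printed 251) l.5–30: "By composing `γ` with an appropriate inner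
automorphism of `Π^tp_{Xβ}`, it follows from [SemiAnbd], Theorem 6.8, (ii), that we may assume that … `γ` … is
compatible with suitable “inversion automorphisms” `ια`, `ιβ` [cf. Proposition 1.5, (iii)]. … it is a tautology
that `γ` is compatible with the symbols “log(Θ)” … the property of mapping to log(Θ) in the quotient `F̈⁰/F̈¹`
and being fixed, up to a unit multiple, under an inversion automorphism completely determines the classes `η̈^Θ`
up to a `(K̈^×)^∧`-multiple" [cite: MochizukiEtTh2009, Thm 1.6 (iii) p.25]; Prop. 1.5 (ii) p. 23 ("`F̈¹/F̈² =
Hom((Δ^tp_Ÿ)^ell/Δ_Θ, Δ_Θ) = Ẑ·log(Ü)`", "`F̈² = H¹(G_K̈, Δ_Θ) ⥲ (K̈^×)^∧`") and (iii) p. 23 (the inversion clause: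
`ι` fixes `η̈^Θ + log(O^×_K̈)` and negates `log(Ü) + log(O^×_K̈)`) [cite: MochizukiEtTh2009, Prop 1.5 (iii) p.23].

abc-iut cell, layer L2, sub-DAG `plan/L2/SUBDAG-EtTh-Thm16.md` (§K row K3; lineage abc-iut-L6-d5, ONE WRITER),
PART 6 — PROOF-ONLY sequel of file (C) (`Thm16SubdagTransport`, p417878: `lift_div_mem_Fdd1` = row L14 filtration
half, `thm16iii_of_core`) producing the inputs `hx` (rows L12–L14) of part 5's `thm16iii_of_cuspValues`
(`Thm16SubdagAssemblyIII`) and `hunits` (row L11 (b)) of `thm16iii_of_core`.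

WHAT THE KERNEL IS MADE TO SAY (Θ-level `H¹((Π^tp_Ÿ)^Θ, Δ_Θ)` of ONE setting `D` — the β side, AFTER
transporting; abc-iut-L2-t1's `Fdd1`, `Fdd2`, `kumYdd`, `logTheta`, `Prop15ii`):
* `Thm16Sub.div_mem_Fdd2_of_inversion` — THE DETERMINATION STEP (rows L13–L14): two classes `x′`, `y′` both
  restricting to `log(Θ)` on `Δ_Θ`, both FIXED UP TO `κ(O^×_K̈)` by an automorphism `ι` of the cohomology group
  which acts by INVERSION on `F̈¹` modulo `F̈²` («`ι` negates `log(Ü) + log(O^×_K̈)`»), differ by an element of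
  `F̈²` — provided `F̈¹/F̈²` has no 2-torsion (print: `F̈¹/F̈² ≅ Ẑ·log(Ü)`, torsion-free). Proof: `d := x′y′⁻¹ ∈ F̈¹`
  (`lift_div_mem_Fdd1`); `ι(d) = d·κ(u₁u₂⁻¹)` hence `ι(d)·d = d²·κ(u₁u₂⁻¹) ∈ F̈²` forces `d² ∈ F̈²`, so `d ∈ F̈²`.
* `Thm16Sub.exists_kum_factor_of_inversion` — «completely determines the classes `η̈^Θ` up to a
  `(K̈^×)^∧`-multiple»: with Prop. 1.5 (ii) `F̈² = κ((K̈^×)^∧)` (`Prop15ii.Fdd2_eq`), `∃ a, x′ = κ(a)·y′`; pushed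
  down to `H¹(Π^tp_Ÿ, Δ_Θ)` along the inflation (`exists_kum_factor_infl_of_inversion`) it is EXACTLY the input
  `hx` of part 5's `thm16iii_of_cuspValues`.
* `Thm16Sub.kumUnitsYdd_map_transport_eq` (+ `_of_unitsHat`) — row L11 (b): the input (hunits) «transport
  carries `κ(O^×_{K̈α})` onto `κ(O^×_{K̈β})`» of file (C)'s `thm16iii_of_core` from Thm. 1.6 (ii)'s clauses for
  the same companion: `δ : (K̈α^×)^∧ ⥲ (K̈β^×)^∧` induced by transport on Kummer classes (a) and carrying
  `O^×_{K̈α}` onto `O^×_{K̈β}` (b) (verbatim at valuation data with `unitsHat = O^×_K̈`).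
The CAPSTONE (Thm16iii from print-shaped inputs only: this file ⟶ part 5 `thm16iii_of_cuspValues` ⟶ file (C))
is the sequel `Thm16SubdagCapstone.lean` (it must import part 5). No `def`, no new `Prop`, nothing asserted.
The two Prop. 1.5 clauses print states but the root interface does not yet type (`ThetaCohomology.lean`:
"NOT typed: the clause on inversion automorphisms `ι`"; `Prop15ii` carries `log(Ü) ∈ F̈¹` and `F̈² = range κ`
but not `F̈¹/F̈² ≅ Ẑ`) enter here as EXPLICIT HYPOTHESES in print shape (sub-DAG debt R14-ι; owner
abc-iut-L2-t1's root, post-freeze). HONEST FRAMING: [EtTh] is refereed and undisputed; nothing here bears on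
[IUTchIII] Cor. 3.12; typed ≠ proved.
-/

noncomputable section

namespace Literature.AnabelianGeometry.EtaleTheta

open Literature.AnabelianGeometry.SemiGraphs

namespace Thm16Sub

variable {p : ℕ} [Fact p.Prime]

/-! ### Rows L13–L14: determination up to `F̈²` -/

section Determination

/-- **Rows L13–L14 — «being fixed, up to a unit multiple, under an inversion automorphism completely determines
the classes … up to» `F̈²`** (Thm. 1.6 (iii) proof, p. 25): in `H¹((Π^tp_Ÿ)^Θ, Δ_Θ)`, let `x′`, `y′` restrict to
the same class on `Δ_Θ` (e.g. both to `log(Θ)`), let `ι` be an automorphism fixing `x′` and `y′` up to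
`κ(O^×_K̈)` and acting by inversion on `F̈¹` modulo `F̈²` (`ι(d)·d ∈ F̈²` for `d ∈ F̈¹` — the Prop 1.5 (iii)
`ι`-clause «negates `log(Ü) + log(O^×_K̈)`» read on `F̈¹/F̈² = Ẑ·log(Ü)`), and let `F̈¹/F̈²` have no 2-torsion
(it is `≅ Ẑ·log(Ü)`). Then `x′·y′⁻¹ ∈ F̈²`. [cite: MochizukiEtTh2009, Thm 1.6 (iii) p.25] -/
theorem div_mem_Fdd2_of_inversion {D : ThetaSetting p} (hC : D.Compat) (E : D.KummerData)
    {x' y' : D.H1Theta (D.GtpYdd.map D.toTheta)}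
    (hres : ContH1.res (MonoidHom.id D.GtpTheta) D.DeltaTheta
        (hC.deltaTheta_le_DtpYddTheta.trans (Subgroup.map_mono inf_le_left)) x' =
      ContH1.res (MonoidHom.id D.GtpTheta) D.DeltaTheta
        (hC.deltaTheta_le_DtpYddTheta.trans (Subgroup.map_mono inf_le_left)) y')
    (ι : D.H1Theta (D.GtpYdd.map D.toTheta) ≃* D.H1Theta (D.GtpYdd.map D.toTheta))
    (hιF1 : ∀ d ∈ ThetaSetting.Fdd1 hC, ι d * d ∈ (ThetaSetting.Fdd2 : Subgroup _))
    (hιx : ∃ u ∈ D.unitsOKdd, ι x' = x' * E.kumYdd (E.toKddHat u))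
    (hιy : ∃ u ∈ D.unitsOKdd, ι y' = y' * E.kumYdd (E.toKddHat u))
    (hkumF2 : ∀ a : E.KddHat, E.kumYdd a ∈ (ThetaSetting.Fdd2 : Subgroup _))
    (htf : ∀ d ∈ ThetaSetting.Fdd1 hC, d * d ∈ (ThetaSetting.Fdd2 : Subgroup _) →
      d ∈ (ThetaSetting.Fdd2 : Subgroup _)) :
    x' * y'⁻¹ ∈ (ThetaSetting.Fdd2 : Subgroup (D.H1Theta (D.GtpYdd.map D.toTheta))) := by
  obtain ⟨u₁, -, hu₁⟩ := hιx
  obtain ⟨u₂, -, hu₂⟩ := hιy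
  set d := x' * y'⁻¹ with hd
  have hdF1 : d ∈ ThetaSetting.Fdd1 hC := div_mem_Fdd1_of_res_eq hC hres
  -- `ι d = d · κ(u₁ u₂⁻¹)`
  have hιd : ι d = d * E.kumYdd (E.toKddHat (u₁ * u₂⁻¹)) := by
    rw [hd, map_mul, map_inv, hu₁, hu₂, map_mul, map_mul, map_inv, map_inv]
    simp only [mul_inv_rev, mul_assoc, mul_comm, mul_left_comm]
  -- `ι d · d = d² · κ(u₁ u₂⁻¹) ∈ F̈²`, hence `d² ∈ F̈²`
  have h2 : d * d ∈ (ThetaSetting.Fdd2 : Subgroup _) := by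
    have h := hιF1 d hdF1
    rw [hιd, mul_assoc, mul_comm (E.kumYdd _), ← mul_assoc] at h
    have := (ThetaSetting.Fdd2 : Subgroup _).mul_mem h
      ((ThetaSetting.Fdd2 : Subgroup _).inv_mem (hkumF2 (E.toKddHat (u₁ * u₂⁻¹))))
    rwa [mul_inv_cancel_right] at this
  exact htf d hdF1 h2

/-- **«… completely determines the classes `η̈^Θ` up to a `(K̈^×)^∧`-multiple»** (p. 25 l.27–28): under the
hypotheses of `div_mem_Fdd2_of_inversion` and Prop. 1.5 (ii) `F̈² = κ((K̈^×)^∧)` (`Prop15ii.Fdd2_eq`), there is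
`a ∈ (K̈^×)^∧` with `x′ = κ(a) · y′`. [cite: MochizukiEtTh2009, Thm 1.6 (iii) p.25] -/
theorem exists_kum_factor_of_inversion {D : ThetaSetting p} (hC : D.Compat) (E : D.KummerData)
    (h15ii : ThetaSetting.Prop15ii E hC)
    {x' y' : D.H1Theta (D.GtpYdd.map D.toTheta)}
    (hres : ContH1.res (MonoidHom.id D.GtpTheta) D.DeltaTheta
        (hC.deltaTheta_le_DtpYddTheta.trans (Subgroup.map_mono inf_le_left)) x' =
      ContH1.res (MonoidHom.id D.GtpTheta) D.DeltaTheta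
        (hC.deltaTheta_le_DtpYddTheta.trans (Subgroup.map_mono inf_le_left)) y')
    (ι : D.H1Theta (D.GtpYdd.map D.toTheta) ≃* D.H1Theta (D.GtpYdd.map D.toTheta))
    (hιF1 : ∀ d ∈ ThetaSetting.Fdd1 hC, ι d * d ∈ (ThetaSetting.Fdd2 : Subgroup _))
    (hιx : ∃ u ∈ D.unitsOKdd, ι x' = x' * E.kumYdd (E.toKddHat u))
    (hιy : ∃ u ∈ D.unitsOKdd, ι y' = y' * E.kumYdd (E.toKddHat u))
    (htf : ∀ d ∈ ThetaSetting.Fdd1 hC, d * d ∈ (ThetaSetting.Fdd2 : Subgroup _) →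
      d ∈ (ThetaSetting.Fdd2 : Subgroup _)) :
    ∃ a : E.KddHat, x' = E.kumYdd a * y' := by
  have hkumF2 : ∀ a : E.KddHat, E.kumYdd a ∈ (ThetaSetting.Fdd2 : Subgroup _) := fun a => by
    rw [h15ii.Fdd2_eq]; exact ⟨a, rfl⟩
  have hd := div_mem_Fdd2_of_inversion hC E hres ι hιF1 hιx hιy hkumF2 htf
  rw [h15ii.Fdd2_eq] at hd
  obtain ⟨a, ha⟩ := hd
  exact ⟨a, by rw [ha, inv_mul_cancel_right]⟩

/-- The same, **pushed down to `H¹(Π^tp_Ÿ, Δ_Θ)`** along the inflation `H¹((Π^tp_Ÿ)^Θ, Δ_Θ) → H¹(Π^tp_Ÿ, Δ_Θ)`: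
if `x′`, `y′` lift `x`, `y` (Prop. 1.5 (iii) lift clause), then `x = infl(κ(a)) · y` — the shape of the input
`hx` of part 5's `thm16iii_of_cuspValues` (rows L12–L14 ⟶ L15). [cite: MochizukiEtTh2009, Thm 1.6 (iii) p.25] -/
theorem exists_kum_factor_infl_of_inversion {D : ThetaSetting p} (hC : D.Compat) (E : D.KummerData)
    (h15ii : ThetaSetting.Prop15ii E hC)
    {x' y' : D.H1Theta (D.GtpYdd.map D.toTheta)} {x y : D.H1 D.GtpYdd}
    (hx : D.inflTheta D.GtpYdd x' = x) (hy : D.inflTheta D.GtpYdd y' = y)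
    (hres : ContH1.res (MonoidHom.id D.GtpTheta) D.DeltaTheta
        (hC.deltaTheta_le_DtpYddTheta.trans (Subgroup.map_mono inf_le_left)) x' =
      ContH1.res (MonoidHom.id D.GtpTheta) D.DeltaTheta
        (hC.deltaTheta_le_DtpYddTheta.trans (Subgroup.map_mono inf_le_left)) y')
    (ι : D.H1Theta (D.GtpYdd.map D.toTheta) ≃* D.H1Theta (D.GtpYdd.map D.toTheta))
    (hιF1 : ∀ d ∈ ThetaSetting.Fdd1 hC, ι d * d ∈ (ThetaSetting.Fdd2 : Subgroup _))
    (hιx : ∃ u ∈ D.unitsOKdd, ι x' = x' * E.kumYdd (E.toKddHat u))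
    (hιy : ∃ u ∈ D.unitsOKdd, ι y' = y' * E.kumYdd (E.toKddHat u))
    (htf : ∀ d ∈ ThetaSetting.Fdd1 hC, d * d ∈ (ThetaSetting.Fdd2 : Subgroup _) →
      d ∈ (ThetaSetting.Fdd2 : Subgroup _)) :
    ∃ a : E.KddHat, x = D.inflTheta D.GtpYdd (E.kumYdd a) * y := by
  obtain ⟨a, ha⟩ := exists_kum_factor_of_inversion hC E h15ii hres ι hιF1 hιx hιy htf
  exact ⟨a, by rw [← hx, ← hy, ha, map_mul]⟩

end Determination

variable {Dα Dβ : ThetaSetting p} {γ : Dα.PiTemp ≃ₜ* Dβ.PiTemp}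

/-! ### Row L11 (b): the unit classes are transported to unit classes, from Thm. 1.6 (ii)'s clauses -/

/-- **Row L11 (b) — input (hunits) of the core assembly from Thm. 1.6 (ii)'s clauses** (p. 24 "preserves …
the kernel of these surjections"): if `δ : (K̈α^×)^∧ ⥲ (K̈β^×)^∧` IS the map induced by transport on Kummer
classes (clause (a) of abc-iut-L2-t1's `Thm16ii`, for the companion `c`) and carries (the image of) `O^×_{K̈α}`
onto (the image of) `O^×_{K̈β}` (clause (b) read with the genuine kernel `unitsHat = O^×_K̈`, cf.
`kumUnitsYdd_map_transport_eq_of_unitsHat`), then transport carries `κ(O^×_{K̈α})` onto `κ(O^×_{K̈β})`.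
[cite: MochizukiEtTh2009, Thm 1.6 (ii) p.24] -/
theorem kumUnitsYdd_map_transport_eq (h : ThetaSetting.Thm16i γ) (c : ThetaSetting.ThetaCompanion γ)
    (Eα : Dα.KummerData) (Eβ : Dβ.KummerData) (δ : Eα.KddHat ≃* Eβ.KddHat)
    (hδ : ∀ a : Eα.KddHat, ThetaSetting.transport c h (Dα.inflTheta Dα.GtpYdd (Eα.kumYdd a)) =
      Dβ.inflTheta Dβ.GtpYdd (Eβ.kumYdd (δ a)))
    (hδU : (Dα.unitsOKdd.map Eα.toKddHat).map δ.toMonoidHom = Dβ.unitsOKdd.map Eβ.toKddHat) :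
    Eα.kumUnitsYdd.map (ThetaSetting.transport c h) = Eβ.kumUnitsYdd := by
  have hfun : (ThetaSetting.transport c h).comp ((Dα.inflTheta Dα.GtpYdd).comp Eα.kumYdd) =
      ((Dβ.inflTheta Dβ.GtpYdd).comp Eβ.kumYdd).comp δ.toMonoidHom := by
    ext a
    exact hδ a
  change ((Dα.unitsOKdd.map Eα.toKddHat).map ((Dα.inflTheta Dα.GtpYdd).comp Eα.kumYdd)).map _ =
    (Dβ.unitsOKdd.map Eβ.toKddHat).map ((Dβ.inflTheta Dβ.GtpYdd).comp Eβ.kumYdd)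
  rw [Subgroup.map_map, hfun, ← hδU]
  simp only [Subgroup.map_map, MonoidHom.comp_assoc]

/-- The same with clause (b) of `Thm16ii` VERBATIM (`Vα.unitsHat.map δ = Vβ.unitsHat`) at valuation data whose
kernel IS the image of the units, `unitsHat = toKddHat(O^×_K̈)` (the genuine case: `O^×_K̈` is compact, hence
closed in `(K̈^×)^∧`; abc-iut-L2's `KummerLevelRecordsNonVacuity` witnesses `ValuationHatData` exactly so).
[cite: MochizukiEtTh2009, Thm 1.6 (ii) p.24] -/
theorem kumUnitsYdd_map_transport_eq_of_unitsHat (h : ThetaSetting.Thm16i γ)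
    (c : ThetaSetting.ThetaCompanion γ) (Eα : Dα.KummerData) (Eβ : Dβ.KummerData)
    (Vα : ThetaSetting.ValuationHatData Dα Eα) (Vβ : ThetaSetting.ValuationHatData Dβ Eβ)
    (hVα : Vα.unitsHat = Dα.unitsOKdd.map Eα.toKddHat) (hVβ : Vβ.unitsHat = Dβ.unitsOKdd.map Eβ.toKddHat)
    (δ : Eα.KddHat ≃* Eβ.KddHat)
    (hδ : ∀ a : Eα.KddHat, ThetaSetting.transport c h (Dα.inflTheta Dα.GtpYdd (Eα.kumYdd a)) =
      Dβ.inflTheta Dβ.GtpYdd (Eβ.kumYdd (δ a)))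
    (hδV : Vα.unitsHat.map δ.toMonoidHom = Vβ.unitsHat) :
    Eα.kumUnitsYdd.map (ThetaSetting.transport c h) = Eβ.kumUnitsYdd :=
  kumUnitsYdd_map_transport_eq h c Eα Eβ δ hδ (by rw [← hVα, ← hVβ, hδV])


end Thm16Sub

end Literature.AnabelianGeometry.EtaleTheta

end
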